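import Mathlib
import HarnessLib
import Summits.NavierStokesRegularity.NavierStokesRegularity.Theorems.UnthreadedRigidityDoorUnthreadedRigidityVirialHornDefs
import Summits.NavierStokesRegularity.NavierStokesRegularity.Theorems.UnthreadedRigidityDoorUnthreadedRigidityVirialHornZonal
import Summits.NavierStokesRegularity.NavierStokesRegularity.Theorems.UnthreadedRigidityDoorUnthreadedRigidityVirialHornWindowAxisUniform
import Summits.NavierStokesRegularity.NavierStokesRegularity.Theorems.UnthreadedRigidityDoorUnthreadedRigidityPersistenceAmplitudeVanishing
import Summits.NavierStokesRegularity.NavierStokesRegularity.Theorems.UnthreadedRigidityDoorUnthreadedRigidityPersistenceCubicLaw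
import Summits.NavierStokesRegularity.NavierStokesRegularity.Theorems.UnthreadedRigidityDoorUnthreadedRigidityPersistenceCubicLawNonexistence
import Summits.NavierStokesRegularity.NavierStokesRegularity.Theorems.UnthreadedRigidityDoorUnthreadedRigidityPersistenceLinearLaw
import Summits.NavierStokesRegularity.NavierStokesRegularity.Theorems.UnthreadedRigidityDoorUnthreadedRigidityPersistenceWindowBalance
import Summits.NavierStokesRegularity.NavierStokesRegularity.Theorems.UnthreadedRigidityDoorUnthreadedRigidityPersistenceLambCurlIdentity
import Summits.NavierStokesRegularity.NavierStokesRegularity.Theorems.UnthreadedRigidityDoorUnthreadedRigidityPersistenceGradSqAffineLaw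
import Summits.NavierStokesRegularity.NavierStokesRegularity.Theorems.UnthreadedRigidityDoorUnthreadedRigidityPersistenceSphereLaw

/-!
# Route `UnthreadedRigidityDoor`, wall item W2 `UnthreadedRigidity` (stmt-NavierStokesRegularity-27585) — LINE g12-2 «PERSISTENCE FILTER»
# (ns-idea-6 g12, `Persistence_sketch.lean` 09bc8f71301208c4; idea-crit-7 PASS B+ with price P1 = bridge M ↦ C′): the kernel-checked
# COMPOSITIONS BY NAME with ALL EIGHT obligations plugged in — ★ single-shell windows VANISH in every degree (the enemy class is EMPTY), UNCONDITIONAL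

Seat ns-es-p1 g9 (W2 second queue, DIRECTOR-NS #294 / KEY-NS #211).  Theorems-side twin of the sketch's §3–§4 compositions, with
* bridge L `singleShellLambCurlIdentity` (p715032), bridge M in the repaired form C′ `windowVorticityBalance_of_ne` (p713454; the sketch's form is
  refuted at `Y ≡ 0`, p713276), S `amplitudeVanishing` (p710551), `cubicLaw` (p711260), `cubicLawNonexistence` (p711985), `linearLaw` (p711202),
  S–M `gradSqAffineLaw` (p713486), S–M `balanceSphereLaw` (`…PersistenceSphereLaw`) — ALL TREE THEOREMS, used by name; nothing is assumed.

Contents (sketch names kept): `sepShellL_null_of_pos` (sketch `shellOfNullProfile_holds`),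
`balancedShellIsNull` (slice core `BalancedShellIsNull l` VERBATIM-unfolded, every degree `l ≥ 1`), ★ `singleShellWindowVanishes` (`SingleShellWindowVanishes l`
VERBATIM: bounded mild windows whose slices are single shells of degree `l` over ONE fixed nonzero solid harmonic, with admissible profiles, are identically
ZERO — every degree), `singleShellWindowVanishesAll` (`SingleShellWindowVanishesAll`).  The weaker window RUNG `IsotypicWindowRigidityL l 1` is already
the tree theorem `ThreadingJets.isotypicWindowRigidityL_one_harmonic` (virial route) and is not re-derived.

HONEST LABEL: plumbing of a files-only RUNG line about SPECIAL single-shell data; `UnthreadedRigidity` (27585), the door Target, W2 and NS regularity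
remain OPEN; nothing here is a statement about general Navier–Stokes solutions; nobody here claims `UnthreadedRigidity`.  0 kit.
-/

noncomputable section

-- the summit and its single sub-problem share the name (CONVENTIONS §1), as in every Theorems file
set_option linter.dupNamespace false

namespace Summit.NavierStokesRegularity.NavierStokesRegularity.Theorems.UnthreadedRigidity.Persistence

open Set Function Filter Topology
open Literature.Analysis.FluidPDE (curl cross)
open Summit.NavierStokesRegularity.NavierStokesRegularity.Theorems.UnthreadedRigidity.ProfileHorn (E3 IsSliceAxisymmetric)
open Summit.NavierStokesRegularity.NavierStokesRegularity.Theorems.UnthreadedRigidity.VirialHorn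

/-! ## §1 Small lemmas (the sketch's, verbatim up to names) -/

/-- a shell whose profile vanishes on `(0,∞)` is the zero field (its poloidal potential vanishes identically; sketch `shellOfNullProfile_holds`). -/
theorem sepShellL_null_of_pos (H : ℝ → ℝ) (Y : E3 → ℝ) (x₀ : E3) (hH : ∀ r : ℝ, 0 < r → H r = 0) (x : E3) :
    sepShellL H Y x₀ x = 0 := by
  have hpot : (fun x : E3 => (H ‖x - x₀‖ * Y (x - x₀)) • (x - x₀)) = fun _ => (0 : E3) := by
    funext z
    by_cases hz : z - x₀ = 0
    · simp [hz]
    · rw [hH _ (norm_pos_iff.mpr hz)]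
      simp
  have h1 : curl (fun _ : E3 => (0 : E3)) = fun _ => (0 : E3) := funext Literature.Analysis.FluidPDE.curl_fun_zero
  unfold sepShellL
  rw [hpot, h1, h1]

/-! ## §2 The slice core in every degree -/

/-- ★ SLICE CORE `BalancedShellIsNull l` (sketch `balancedShellIsNull_of_laws` with I, S, G, A, C, CN, L discharged BY NAME): a toroidally balanced
admissible single shell of degree `l ≥ 1` over a nonzero solid harmonic, with analytic profile, has NULL profile.  (Balance via bridge L =
`∇ψ × y = e(|y|) ∇Y × y`; sphere law ⇒ `b_l[H] ≡ 0` and, where `Kα ≠ 0`, `|∇Y|²` affine in `Y` on `S²`; `l = 1`: linear law; `l ≥ 2`: either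
`Kα ≡ 0` (amplitude vanishing) or the affine-gradient law forces `l = 2`, then cubic law + non-existence.) -/
theorem balancedShellIsNull (l : ℕ) (hl : 1 ≤ l) :
    ∀ (H : ℝ → ℝ) (Y : E3 → ℝ) (x₀ : E3), IsSolidHarmonic l Y → (∃ y, Y y ≠ 0) → VirialAdmissible l H →
      AnalyticOnNhd ℝ H (Set.Ioi 0) →
      (∃ e : ℝ → ℝ, ∀ y : E3, y ≠ 0 →
        curl (fun x => cross (curl (sepShellL H Y x₀) x) (sepShellL H Y x₀ x)) (x₀ + y)
          = e ‖x₀ + y - x₀‖ • cross (gradient Y (x₀ + y - x₀)) (x₀ + y - x₀)) →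
      ∀ r : ℝ, 0 < r → H r = 0 := by
  intro H Y x₀ hY hYne hAdm han hbal
  -- the balance through the identity: `∇ψ × y = e(|y|) ∇Y × y`
  obtain ⟨e, he⟩ := hbal
  have he' : ∀ y : E3, y ≠ 0 →
      cross (gradient (fun y => -(vortAmpL l H ‖y‖ * strainAmpL l H ‖y‖) * ‖gradient Y y‖ ^ 2
          + (l : ℝ) / (2 * ‖y‖) * (((l : ℝ) - 1) * vortAmpL l H ‖y‖ * deriv H ‖y‖
              - ((l : ℝ) + 1) * deriv (vortAmpL l H) ‖y‖ * H ‖y‖) * Y y ^ 2) y) y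
        = e ‖y‖ • cross (gradient Y y) y := fun y hy => by
    rw [← singleShellLambCurlIdentity l H Y x₀ hl hY hAdm y hy, he y hy]
    simp only [add_sub_cancel_left]
  obtain ⟨hb, haff⟩ := balanceSphereLaw l H Y e hl hY hYne hAdm he'
  rcases Nat.lt_or_ge l 2 with h1 | h2
  · -- `l = 1`: the linear law
    have h1' : l = 1 := by omega
    subst h1'
    exact linearLaw H hAdm han hb
  · by_cases hKα : ∀ r : ℝ, 0 < r → vortAmpL l H r * strainAmpL l H r = 0
    · exact amplitudeVanishing l H hl hAdm han hKα
    · simp only [not_forall] at hKα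
      obtain ⟨r, hr, hne⟩ := hKα
      obtain ⟨h2', -⟩ := gradSqAffineLaw l Y h2 hY hYne (haff r hr hne)
      subst h2'
      exact cubicLawNonexistence H hAdm han (cubicLaw H hAdm han hb)

/-! ## §3 Single-shell windows vanish, every degree -/

/-- ★ RUNG «SINGLE-SHELL WINDOWS VANISH» `SingleShellWindowVanishes l`, every degree `l ≥ 1` (sketch `singleShellWindowVanishes_of_core` with bridge M in the
repaired form C′ `windowVorticityBalance_of_ne` — the window statement carries `(∃ y, Y y ≠ 0)`, so C′ suffices): a bounded mild window (27585's
hypotheses WITHOUT unthreadedness and preconnectedness) whose slices are single shells of degree `l` over ONE fixed nonzero solid harmonic `Y`, with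
admissible profiles, is identically zero. -/
theorem singleShellWindowVanishes (l : ℕ) (hl : 1 ≤ l) :
    ∀ (S : Set ℝ), IsOpen S → ∀ (u : ℝ → E3 → E3) (x₀ : E3),
      ContinuousOn (Function.uncurry u) (S ×ˢ Set.univ) →
      (∀ t ∈ S, Literature.Analysis.FluidPDE.VectorCalculus.IsDivFree (u t)) →
      (∀ s ∈ S, ∀ t ∈ S, s < t → ∀ x, u t x =
          Literature.Analysis.UnboundedOperators.heatExtension (u s) (t - s) x
            - Literature.Analysis.FluidPDE.oseenDuhamel 1 s u u t x) →
      (∀ τ ∈ S, ∃ B : ℝ, ∀ t ∈ S, t ≤ τ → ∀ x, ‖u t x‖ ≤ B) →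
      ∀ (Y : E3 → ℝ) (Hf : ℝ → ℝ → ℝ), IsSolidHarmonic l Y → (∃ y, Y y ≠ 0) →
        (∀ t ∈ S, VirialAdmissible l (Hf t)) → (∀ t ∈ S, u t = sepShellL (Hf t) Y x₀) →
        ∀ t ∈ S, ∀ x, u t x = 0 := by
  intro S hS u x₀ hcont hdiv hmild hbdd Y Hf hY hYne hAdm hshape t ht x
  obtain ⟨hbal, han⟩ := windowVorticityBalance_of_ne S hS u x₀ hcont hdiv hmild hbdd l Y Hf hl hY hYne hAdm hshape t ht
  have hH : ∀ r : ℝ, 0 < r → Hf t r = 0 := by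
    refine balancedShellIsNull l hl (Hf t) Y x₀ hY hYne (hAdm t ht) han ?_
    rw [← hshape t ht]
    exact hbal
  rw [hshape t ht]
  exact sepShellL_null_of_pos (Hf t) Y x₀ hH x

/-! ## §4 All degrees at once -/

/-- ★ `SingleShellWindowVanishesAll` (the sketch's probe target): single-shell windows vanish in EVERY degree `l ≥ 1`.  (The weaker window RUNG
`IsotypicWindowRigidityL l 1` — rigidity rather than emptiness of the class — is already the tree theorem
`ThreadingJets.isotypicWindowRigidityL_one_harmonic` by the virial route; it is not re-derived here.) -/
theorem singleShellWindowVanishesAll : ∀ l : ℕ, 1 ≤ l →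
    ∀ (S : Set ℝ), IsOpen S → ∀ (u : ℝ → E3 → E3) (x₀ : E3),
      ContinuousOn (Function.uncurry u) (S ×ˢ Set.univ) →
      (∀ t ∈ S, Literature.Analysis.FluidPDE.VectorCalculus.IsDivFree (u t)) →
      (∀ s ∈ S, ∀ t ∈ S, s < t → ∀ x, u t x =
          Literature.Analysis.UnboundedOperators.heatExtension (u s) (t - s) x
            - Literature.Analysis.FluidPDE.oseenDuhamel 1 s u u t x) →
      (∀ τ ∈ S, ∃ B : ℝ, ∀ t ∈ S, t ≤ τ → ∀ x, ‖u t x‖ ≤ B) →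
      ∀ (Y : E3 → ℝ) (Hf : ℝ → ℝ → ℝ), IsSolidHarmonic l Y → (∃ y, Y y ≠ 0) →
        (∀ t ∈ S, VirialAdmissible l (Hf t)) → (∀ t ∈ S, u t = sepShellL (Hf t) Y x₀) →
        ∀ t ∈ S, ∀ x, u t x = 0 := fun l hl =>
  singleShellWindowVanishes l hl

end Summit.NavierStokesRegularity.NavierStokesRegularity.Theorems.UnthreadedRigidity.Persistence

end
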